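import Mathlib.Algebra.BigOperators.Fin
import Mathlib.Data.ZMod.Basic
import Mathlib.GroupTheory.SpecificGroups.Quaternion
import Mathlib.Tactic.FinCases
import Mathlib.Tactic.Ring

/-!
# Octic atlas, type `Q₈`: quaternion octic CM fields — the Hodge lattice of the whole `F`-slice needs TWO Galois orbits on `B₀ × B₁` (kernel census)

COR-CM (cell `pub-hodgecm2`), count-neutral kernel census by the PORTFOLIO seat lit-andre-3 (gen 8): the OCTIC ATLAS — the
species-basis method of `Census/DihedralFourCoreLattice.lean` (gen 7, the `D₄` type) run over the WHOLE `F`-slice for each of the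
six Galois CM closure types `(G, c)` of order `8` (`G = Gal(F/ℚ)`, `c` = complex conjugation, central): `ℤ/8`, `ℤ/4 × ℤ/2` with `c`
a square, `ℤ/4 × ℤ/2` with `c` a non-square, `(ℤ/2)³`, `D₄` (gen 7), `Q₈`.  Cell note `HOME/pub-hodgecm2-lit-andre-3/PORTFOLIO-lit-andre-3-g8.md`.
No named fact, no geometry, no `sorry`: `decide`, `simp`, `ring`, `omega` only.

DICTIONARY (cited, not formalised).  `F` a Galois CM field, `G = Gal(F/ℚ) = Hom(F, ℚ̄)` (one embedding fixed), `c ∈ Z(G)`.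
A CM type of `(G,c)` is `T ⊆ G` with `T ⊔ cT = G` (`cmTypes`).  Isogeny classes of simple CM abelian varieties `A` SPLIT BY `F`
(`End⁰(A) = K ⊆ F`) ↔ pairs `(K, φ)` with `φ` primitive ↔ `G`-orbits of CM types of `F` [cite: Milne1999, Prop. 2.1 and the
paragraph following it, p. 54]; in this file's convention the orbit is under RIGHT translation `T ↦ T·g` (the same complex torus
with its `F`-structure twisted by `g`), the right stabiliser `H = Stab(T)` cuts out `K = F^H`, `dim A = |G| / 2|H|`, and the
embeddings `K → ℚ̄` = the cosets `G/H` = the labels of the CM eigenvectors `e_x` of `H¹(A, ℚ̄)`; LEFT translation (`act`) is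
Galois conjugation of eigenvectors / of coefficients (`types_census`: the orbits, stabilisers and sizes).  For `Z` isogenous to
`∏_b A_b^{n_b}` a class monomial (a wedge of eigenvectors spread over the copies) has an EXPONENT VECTOR `m : Pt → ℕ`
(`m_x ≤ n_b`), and it is a Hodge class iff `hodgeForm g m = 0` for all `g ∈ G` — Pohlmann's criterion [cite: Pohlmann1968, Thm 1]
(= [cite: GaoUllmo2025, Thm 3.1]; dictionary (D) of `Census/DihedralFourCoreLattice.lean`); the conjugate pairs `{x, cx}` are the
divisor classes (`NS ⊗ ℚ̄` of the factors, Lefschetz `(1,1)`).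

KERNEL.  `types_census` · `sanity` · `hodgeForm_expand` · `isHodgeVec_iff` (LATTICE THEOREM: the Hodge lattice `H ⊂ ℤ^{16}` of the
slice is `ℤ⟨8 conjugate pairs, 4 atoms⟩`, rank `12`; `combo_eq_zero`: a basis) · `atom_orbits` (the basis atoms are Galois
translates of the minimal orbit representatives `orbitRep`) · `parity_obstruction` (the deficiency is minimal).

THIS TYPE.  `G = Q₈`, realised as Mathlib's `QuaternionGroup 2` (`a i`, `xa i`, `i ∈ ℤ/4`), `c = a 2` (the central involution);
e.g. `F = ℚ(√(−(2+√2)(3+√3)))` (Galois over `ℚ`; its three quartic sub-extensions over `ℚ(√2)`, `ℚ(√3)`, `ℚ(√6)` are cyclic, so the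
group is `Q₈`; totally imaginary quadratic over `F⁺ = ℚ(√2, √3)`).  Every non-trivial subgroup of `Q₈` contains `c`, so `F` has NO
proper CM subfield: all `16` CM types are primitive; `types_census`: two right-translation orbits of `8`, i.e. exactly two simple
CM abelian varieties are split by `F`, the FOURFOLDS `B₀` (type `{a 0, a 1, xa 0, xa 1}`) and `B₁` (type `{a 0, a 1, xa 0, xa 3}`), both
with CM by `F`, not isogenous (each orbit is also stable under left translation: each isogeny class is Galois-stable); labels
`q i g`, `g ∈ Q₈`, `act` = LEFT multiplication.  The slice is the family `B₀^a × B₁^b`.  NUMBERS (exact): `16` labels, Hodge forms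
of rank `4`, `H` of rank `12`, `8` pairs, `H/⟨pairs⟩ ≅ ℤ⁴`; no exceptional Hodge class on `B₀^a`, `B₁^b` or any carrier of dimension
`≤ 7`; atoms live on `B₀ × B₁` (`392` Hodge monomials outside `ℤ⟨pairs⟩` in `49` orbits; NO single orbit generates — `33` of the
`34` middle-degree orbit classes give index `2`, one gives index `8`).
DEFICIENCY `μ = 2` (`363` minimal pairs of orbits; preferred): `R₀ = orbitRep 0 = {q 0 (xa 2), q 0 (xa 3), q 1 (a 1), q 1 (xa 0)}`,
`R₁ = orbitRep 1 = {q 0 (a 3), q 0 (xa 3), q 1 (a 0), q 1 (a 1)}`, both on `Y = B₀ × B₁` (dimension `8`) of Künneth type `(2,2) ⊂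
H²(B₀) ⊗ H²(B₁)`, orbits of size `8`; on each factor the orbit's partial wedges span a rank-`8` weight-`2` sub-Hodge structure
with Hodge numbers `(2,4,2)` (`N₀^{(j)} ⊂ H²(B₀, ℚ)`, `N₁^{(j)} ⊂ H²(B₁, ℚ)`), and `W_j` = graph classes of a Hodge isomorphism
`N₀^{(j)} ≅ N₁^{(j)}` (up to twist/duality).  In contrast with the cyclic type `ℤ/8` (ONE orbit, odd Künneth bidegree), here every
usable orbit has EVEN bidegree (`(2,2), (2,4), (4,2), (2,6), (6,2), (4,4)`).
PARITY (`parity_obstruction`): `paritySet 0 = B₀`-labels in the cyclic subgroup `⟨xa 0⟩ = {a 0, a 2, xa 0, xa 2}`, `paritySet 1 =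
B₀`-labels in `⟨a 1⟩ = {a 0, a 1, a 2, a 3}`: the number of `B₀`-eigenvectors with label in an index-`2` subgroup, mod `2`, is a
`G`-invariant killing the pairs; two of the three are independent on `H`: no single orbit generates.

THEOREM (informal; complete given the operations (O1)–(O3) and the density argument (O2)/(O4) of `Census/DihedralFourCoreLattice.lean`,
whose inputs are cited there).  Let `Z` be ANY abelian variety isogenous to a product of powers of the simple factors listed above
(any exponents `≥ 0`).  If, for each of the `μ` orbit representatives `R_j` (`orbitRep`), ONE algebraic class on its carrier `Y_j`
has a non-zero component on the eigenline `⊗_{x ∈ R_j} e_x` — implied by the Hodge conjecture for the `ℚ`-Hodge structure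
`W_j ⊂ H⁴(Y_j, ℚ)` spanned by the orbit (`dim W_j = |orbit|`) — then EVERY Hodge class on `Z` is algebraic.  Conversely the `Y_j`
are members of the family, and by `parity_obstruction` no family of fewer than `μ` Galois orbits of Hodge monomials generates.
Proof: by `isHodgeVec_iff` a Hodge exponent vector `m ≥ 0` of `Z` is `Σ a_p·pair_p + Σ w_k·atom_k` over `ℤ`; `−atom = c·atom −
(its pairs)` and `c ∈ G` make all `w_k ≥ 0`; adding pairs to both sides makes all coefficients `≥ 0`; the right side is realised
on a larger power as a cup product of pull-backs of divisor classes and of Galois conjugates (O1) of the eigen-projections (O2)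
of the given classes; the added pairs are deleted by the correspondences (O3) (`m_{ij}^*θ − pr_i^*θ − pr_j^*θ`, `θ^{g−1}`), the
copies merged along partial diagonals, and (O2) finishes (`H_m(Z)` is an irreducible module of the span of `End(Z)^*`).
MARKMAN.  Exact oracle (`scratch/closure_slice.py`, not re-decided here): EVERY Hodge monomial whose carrier has dimension `≤ 5`
lies in `ℤ⟨pairs⟩` — the slice has no exceptional Hodge class in dimension `≤ 5`, so `Markman2025_weilClasses_algebraic_abelianFourfold`
and the cell's dimension-`≤ 5` theorem `CMWeights.hodgeConjectureFor_of_isOfCMType_dim_le_five_of_markman` do not touch the atoms.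
So: HC for EVERY `B₀^a × B₁^b` ⟺ TWO codimension-`2` statements on the `8`-fold `B₀ × B₁` (two independent Hodge isomorphisms
between weight-`2` pieces of `H²(B₀)` and `H²(B₁)` are algebraic).  Open in print as far as the seat knows.

## References
* [Pohlmann1968] H. Pohlmann, Algebraic cycles on abelian varieties of complex multiplication type, Ann. of Math. 88 (1968), Thm 1.
* [GaoUllmo2025] Z. Gao, E. Ullmo, JIMJ 25 (2025), Thm 3.1.  [Milne1999] J. S. Milne, Lefschetz motives and the Tate conjecture,
  Compositio Math. 117 (1999), Prop. 2.1, p. 54.  [Markman2025SurveySecant] E. Markman, arXiv:2509.23403, Thm 1.2 (not applicable here).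

## Provenance
Exact oracles (seat folder, copies in `HOME/pub-hodgecm2-lit-andre-3/g8/`): `scratch/closure_slice.py` (slice model, Hodge lattice,
Markman sublattice, atom search), `scratch/atlas8d.py` (global minimal atom families), `scratch/mu.py` (coinvariants, parity
functionals), `scratch/gen_octic2.py` (this file: unimodular `12 × 12` minor, integral inverse = the witnesses of `isHodgeVec_iff`).
-/

namespace Summit.HodgeConjecture.CorCM.Census.OcticQuaternionSpecies

open Finset QuaternionGroup

/-! ## The CM types of `(G, c)` and the simple factors -/

/-- The CM types of `(G,c)` as subsets `T ⊆ G`: for every `g` exactly one of `g`, `cg` lies in `T`. [folklore] -/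
def cmTypes : Finset (Finset (QuaternionGroup 2)) := univ.powerset.filter fun T => ∀ g : QuaternionGroup 2, g ∈ T ↔ (a 2 : QuaternionGroup 2) * g ∉ T

/-- The CM types of the simple factors (one representative per factor; as subsets of `G = Hom(F, ℚ̄)`). [folklore] -/
def blockType : Fin 2 → Finset (QuaternionGroup 2) := ![{a 0, a 1, xa 0, xa 1}, {a 0, a 1, xa 0, xa 3}]

set_option maxRecDepth 4000 in
/-- **Types census.**  `(G,c)` has exactly `16` CM types; they are exactly the right translates `T·g` (same variety, CM
structure twisted by `g`) of the 2 block types; the right stabilisers (the block type is induced from the CM subfield they fix)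
and the orbit sizes `8+8` (summing to `16`, so the orbits are disjoint: the simple factors are pairwise non-isogenous and
exhaust the simple CM abelian varieties split by `F`). [folklore] -/
theorem types_census : cmTypes.card = 16 ∧
    cmTypes = (univ ×ˢ (univ : Finset (Fin 2))).image (fun p => (blockType p.2).image (fun t => t * p.1)) ∧
    ((univ.filter fun g : QuaternionGroup 2 => (blockType 0).image (fun t => t * g) = blockType 0) = {a 0} ∧
    (univ.filter fun g : QuaternionGroup 2 => (blockType 1).image (fun t => t * g) = blockType 1) = {a 0}) ∧
    ((univ.image fun g : QuaternionGroup 2 => (blockType 0).image (fun t => t * g)).card = 8 ∧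
    (univ.image fun g : QuaternionGroup 2 => (blockType 1).image (fun t => t * g)).card = 8) := by
  refine ⟨by decide, by decide, ⟨by decide, by decide⟩, ⟨by decide, by decide⟩⟩

/-! ## Labels, action, total type -/

/-- Labels of the CM eigenvectors of `H¹` of the simple factors (block `b` ↦ `G / Stab(blockType b)`). [folklore] -/
abbrev Pt := Fin 2 × QuaternionGroup 2

/-- `q i g`: the eigenvector label `g ∈ Q₈` (an embedding of `F`) of block `i` (`B₀`: `i = 0`, `B₁`: `i = 1`). [folklore] -/
abbrev q (i : Fin 2) (g : QuaternionGroup 2) : Pt := (i, g)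

/-- `G = Q₈` (Mathlib's `QuaternionGroup 2`: `a i`, `xa i`, `i ∈ ℤ/4`; centre `{a 0, a 2}`, `c = a 2`) acts on the labels by LEFT
multiplication (Galois conjugation of eigenvectors). [folklore] -/
def act (g : QuaternionGroup 2) (x : Pt) : Pt := (x.1, g * x.2)

/-- The total CM type `Φ` (eigenvectors of Hodge type `(1,0)`), block by block = the images of the block types. [folklore] -/
def phi : Finset Pt := {q 0 (a 0), q 0 (a 1), q 0 (xa 0), q 0 (xa 1), q 1 (a 0), q 1 (a 1), q 1 (xa 0), q 1 (xa 3)}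

/-- The eight elements of `Q₈`. [folklore] -/
theorem univ_q8 : (univ : Finset (QuaternionGroup 2)) = {a 0, a 1, a 2, a 3, xa 0, xa 1, xa 2, xa 3} := by decide

/-- `Φ` is a CM type for `c = (a 2 : QuaternionGroup 2)`, and `act` is a left action of `G` (closed sanity check). [folklore] -/
theorem sanity : (∀ x : Pt, x ∈ phi ↔ act (a 2 : QuaternionGroup 2) x ∉ phi) ∧ (∀ g h : QuaternionGroup 2, ∀ x : Pt, act (g * h) x = act g (act h x)) ∧
    (∀ x : Pt, act 1 x = x) := by
  refine ⟨by decide, by decide, by decide⟩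

/-! ## Pohlmann's Hodge forms and the lattice theorem -/

/-- Pohlmann's Hodge functional of `g ∈ G` on integer exponent vectors `m : Pt → ℤ` of power-products of the simple factors:
`Σ_x (2[g·x ∈ Φ] − 1) m_x`; `m ≥ 0` is the exponent vector of a Hodge monomial iff all of them vanish. [cite: Pohlmann1968, Thm 1] -/
def hodgeForm (g : QuaternionGroup 2) (m : Pt → ℤ) : ℤ := ∑ x : Pt, (if act g x ∈ phi then m x else -m x)

/-- Indicator vector of a set of labels (a square-free monomial). [folklore] -/
def wt (P : Finset Pt) (x : Pt) : ℤ := if x ∈ P then 1 else 0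

/-- The conjugate pair through a label (a divisor-class monomial). [folklore] -/
def pairOf (x : Pt) : Finset Pt := {x, act (a 2 : QuaternionGroup 2) x}

/-- Representatives of the 2 minimal ATOM orbits (exponent sets of Hodge monomials; carriers and Künneth types in the module doc). [folklore] -/
def orbitRep : Fin 2 → Finset Pt := ![{q 0 (xa 2), q 0 (xa 3), q 1 (a 1), q 1 (xa 0)}, {q 0 (a 3), q 0 (xa 3), q 1 (a 0), q 1 (a 1)}]

/-- The four atom monomials of the basis (`atom_orbits`: `G`-translates of the orbit representatives). [folklore] -/
def atom : Fin 4 → Finset Pt := ![{q 0 (xa 2), q 0 (xa 3), q 1 (a 1), q 1 (xa 0)}, {q 0 (xa 1), q 0 (xa 2), q 1 (a 2), q 1 (xa 3)}, {q 0 (a 2), q 0 (a 3), q 1 (a 0), q 1 (xa 3)}, {q 0 (a 3), q 0 (xa 3), q 1 (a 0), q 1 (a 1)}]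

/-- Each basis atom is a `G`-translate (Galois-conjugate monomial) of the representative of its orbit. [folklore] -/
theorem atom_orbits : atom 0 = (orbitRep 0).image (act (a 0 : QuaternionGroup 2)) ∧
    atom 1 = (orbitRep 0).image (act (a 1 : QuaternionGroup 2)) ∧
    atom 2 = (orbitRep 0).image (act (xa 2 : QuaternionGroup 2)) ∧
    atom 3 = (orbitRep 1).image (act (a 0 : QuaternionGroup 2)) := by
  refine ⟨by decide, by decide, by decide, by decide⟩

/-- Explicit sum over `Q₈`. [folklore] -/
theorem sum_q8 (f : QuaternionGroup 2 → ℤ) :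
    ∑ g : QuaternionGroup 2, f g = f (a 0) + f (a 1) + f (a 2) + f (a 3) + f (xa 0) + f (xa 1) + f (xa 2) + f (xa 3) := by
  rw [univ_q8]
  repeat rw [Finset.sum_insert (by decide)]
  rw [Finset.sum_singleton]
  ring

/-- Case analysis over the sixteen labels. [folklore] -/
theorem forall_pt (p : Pt → Prop) : (∀ x, p x) ↔ p (q 0 (a 0)) ∧ p (q 0 (a 1)) ∧ p (q 0 (a 2)) ∧ p (q 0 (a 3)) ∧ p (q 0 (xa 0)) ∧ p (q 0 (xa 1)) ∧ p (q 0 (xa 2)) ∧ p (q 0 (xa 3)) ∧ p (q 1 (a 0)) ∧ p (q 1 (a 1)) ∧ p (q 1 (a 2)) ∧ p (q 1 (a 3)) ∧ p (q 1 (xa 0)) ∧ p (q 1 (xa 1)) ∧ p (q 1 (xa 2)) ∧ p (q 1 (xa 3)) := by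
  have hu : (univ : Finset Pt) = {q 0 (a 0), q 0 (a 1), q 0 (a 2), q 0 (a 3), q 0 (xa 0), q 0 (xa 1), q 0 (xa 2), q 0 (xa 3), q 1 (a 0), q 1 (a 1), q 1 (a 2), q 1 (a 3), q 1 (xa 0), q 1 (xa 1), q 1 (xa 2), q 1 (xa 3)} := by decide
  rw [show (∀ x, p x) ↔ ∀ x ∈ (univ : Finset Pt), p x from ⟨fun h x _ => h x, fun h x => h x (mem_univ x)⟩, hu]
  simp only [mem_insert, mem_singleton, forall_eq_or_imp, forall_eq]

/-- Case analysis over the eight group elements. [folklore] -/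
theorem forall_g (p : QuaternionGroup 2 → Prop) : (∀ g, p g) ↔ p (a 0) ∧ p (a 1) ∧ p (a 2) ∧ p (a 3) ∧ p (xa 0) ∧ p (xa 1) ∧ p (xa 2) ∧ p (xa 3) := by
  rw [show (∀ g, p g) ↔ ∀ g ∈ (univ : Finset (QuaternionGroup 2)), p g from ⟨fun h g _ => h g, fun h g => h g (mem_univ g)⟩, univ_q8]
  simp only [mem_insert, mem_singleton, forall_eq_or_imp, forall_eq]

/-- The eight Hodge forms, expanded. [cite: Pohlmann1968, Thm 1] -/
theorem hodgeForm_expand (m : Pt → ℤ) :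
    hodgeForm (a 0 : QuaternionGroup 2) m = m (q 0 (a 0)) + m (q 0 (a 1)) - m (q 0 (a 2)) - m (q 0 (a 3)) + m (q 0 (xa 0)) + m (q 0 (xa 1)) - m (q 0 (xa 2)) - m (q 0 (xa 3)) + m (q 1 (a 0)) + m (q 1 (a 1)) - m (q 1 (a 2)) - m (q 1 (a 3)) + m (q 1 (xa 0)) - m (q 1 (xa 1)) - m (q 1 (xa 2)) + m (q 1 (xa 3)) ∧
    hodgeForm (a 1 : QuaternionGroup 2) m = m (q 0 (a 0)) - m (q 0 (a 1)) - m (q 0 (a 2)) + m (q 0 (a 3)) - m (q 0 (xa 0)) + m (q 0 (xa 1)) + m (q 0 (xa 2)) - m (q 0 (xa 3)) + m (q 1 (a 0)) - m (q 1 (a 1)) - m (q 1 (a 2)) + m (q 1 (a 3)) + m (q 1 (xa 0)) + m (q 1 (xa 1)) - m (q 1 (xa 2)) - m (q 1 (xa 3)) ∧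
    hodgeForm (a 2 : QuaternionGroup 2) m = -m (q 0 (a 0)) - m (q 0 (a 1)) + m (q 0 (a 2)) + m (q 0 (a 3)) - m (q 0 (xa 0)) - m (q 0 (xa 1)) + m (q 0 (xa 2)) + m (q 0 (xa 3)) - m (q 1 (a 0)) - m (q 1 (a 1)) + m (q 1 (a 2)) + m (q 1 (a 3)) - m (q 1 (xa 0)) + m (q 1 (xa 1)) + m (q 1 (xa 2)) - m (q 1 (xa 3)) ∧
    hodgeForm (a 3 : QuaternionGroup 2) m = -m (q 0 (a 0)) + m (q 0 (a 1)) + m (q 0 (a 2)) - m (q 0 (a 3)) + m (q 0 (xa 0)) - m (q 0 (xa 1)) - m (q 0 (xa 2)) + m (q 0 (xa 3)) - m (q 1 (a 0)) + m (q 1 (a 1)) + m (q 1 (a 2)) - m (q 1 (a 3)) - m (q 1 (xa 0)) - m (q 1 (xa 1)) + m (q 1 (xa 2)) + m (q 1 (xa 3)) ∧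
    hodgeForm (xa 0 : QuaternionGroup 2) m = m (q 0 (a 0)) + m (q 0 (a 1)) - m (q 0 (a 2)) - m (q 0 (a 3)) - m (q 0 (xa 0)) - m (q 0 (xa 1)) + m (q 0 (xa 2)) + m (q 0 (xa 3)) + m (q 1 (a 0)) - m (q 1 (a 1)) - m (q 1 (a 2)) + m (q 1 (a 3)) - m (q 1 (xa 0)) - m (q 1 (xa 1)) + m (q 1 (xa 2)) + m (q 1 (xa 3)) ∧
    hodgeForm (xa 1 : QuaternionGroup 2) m = m (q 0 (a 0)) - m (q 0 (a 1)) - m (q 0 (a 2)) + m (q 0 (a 3)) + m (q 0 (xa 0)) - m (q 0 (xa 1)) - m (q 0 (xa 2)) + m (q 0 (xa 3)) - m (q 1 (a 0)) - m (q 1 (a 1)) + m (q 1 (a 2)) + m (q 1 (a 3)) + m (q 1 (xa 0)) - m (q 1 (xa 1)) - m (q 1 (xa 2)) + m (q 1 (xa 3)) ∧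
    hodgeForm (xa 2 : QuaternionGroup 2) m = -m (q 0 (a 0)) - m (q 0 (a 1)) + m (q 0 (a 2)) + m (q 0 (a 3)) + m (q 0 (xa 0)) + m (q 0 (xa 1)) - m (q 0 (xa 2)) - m (q 0 (xa 3)) - m (q 1 (a 0)) + m (q 1 (a 1)) + m (q 1 (a 2)) - m (q 1 (a 3)) + m (q 1 (xa 0)) + m (q 1 (xa 1)) - m (q 1 (xa 2)) - m (q 1 (xa 3)) ∧
    hodgeForm (xa 3 : QuaternionGroup 2) m = -m (q 0 (a 0)) + m (q 0 (a 1)) + m (q 0 (a 2)) - m (q 0 (a 3)) - m (q 0 (xa 0)) + m (q 0 (xa 1)) + m (q 0 (xa 2)) - m (q 0 (xa 3)) + m (q 1 (a 0)) + m (q 1 (a 1)) - m (q 1 (a 2)) - m (q 1 (a 3)) - m (q 1 (xa 0)) + m (q 1 (xa 1)) + m (q 1 (xa 2)) - m (q 1 (xa 3)) := by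
  refine ⟨?_, ?_, ?_, ?_, ?_, ?_, ?_, ?_⟩ <;>
  · simp (config := { decide := true }) only [hodgeForm, Fintype.sum_prod_type, Fin.sum_univ_two, sum_q8, ↓reduceIte]
    ring

/-- Integral combinations of the twelve generators: the eight conjugate pairs (`a0 … a7`) and the four atoms (`w0 … w3`). [folklore] -/
def combo (a0 a1 a2 a3 a4 a5 a6 a7 w0 w1 w2 w3 : ℤ) (x : Pt) : ℤ :=
  a0 * wt (pairOf (q 0 (a 0))) x + a1 * wt (pairOf (q 0 (a 1))) x + a2 * wt (pairOf (q 0 (xa 0))) x + a3 * wt (pairOf (q 0 (xa 1))) x +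
  a4 * wt (pairOf (q 1 (a 0))) x + a5 * wt (pairOf (q 1 (a 1))) x + a6 * wt (pairOf (q 1 (xa 0))) x + a7 * wt (pairOf (q 1 (xa 1))) x +
  w0 * wt (atom 0) x + w1 * wt (atom 1) x + w2 * wt (atom 2) x + w3 * wt (atom 3) x

/-- `combo` at the sixteen labels. [folklore] -/
theorem combo_expand (a0 a1 a2 a3 a4 a5 a6 a7 w0 w1 w2 w3 : ℤ) :
    combo a0 a1 a2 a3 a4 a5 a6 a7 w0 w1 w2 w3 (q 0 (a 0)) = a0 ∧
    combo a0 a1 a2 a3 a4 a5 a6 a7 w0 w1 w2 w3 (q 0 (a 1)) = a1 ∧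
    combo a0 a1 a2 a3 a4 a5 a6 a7 w0 w1 w2 w3 (q 0 (a 2)) = a0 + w2 ∧
    combo a0 a1 a2 a3 a4 a5 a6 a7 w0 w1 w2 w3 (q 0 (a 3)) = a1 + w2 + w3 ∧
    combo a0 a1 a2 a3 a4 a5 a6 a7 w0 w1 w2 w3 (q 0 (xa 0)) = a2 ∧
    combo a0 a1 a2 a3 a4 a5 a6 a7 w0 w1 w2 w3 (q 0 (xa 1)) = a3 + w1 ∧
    combo a0 a1 a2 a3 a4 a5 a6 a7 w0 w1 w2 w3 (q 0 (xa 2)) = a2 + w0 + w1 ∧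
    combo a0 a1 a2 a3 a4 a5 a6 a7 w0 w1 w2 w3 (q 0 (xa 3)) = a3 + w0 + w3 ∧
    combo a0 a1 a2 a3 a4 a5 a6 a7 w0 w1 w2 w3 (q 1 (a 0)) = a4 + w2 + w3 ∧
    combo a0 a1 a2 a3 a4 a5 a6 a7 w0 w1 w2 w3 (q 1 (a 1)) = a5 + w0 + w3 ∧
    combo a0 a1 a2 a3 a4 a5 a6 a7 w0 w1 w2 w3 (q 1 (a 2)) = a4 + w1 ∧
    combo a0 a1 a2 a3 a4 a5 a6 a7 w0 w1 w2 w3 (q 1 (a 3)) = a5 ∧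
    combo a0 a1 a2 a3 a4 a5 a6 a7 w0 w1 w2 w3 (q 1 (xa 0)) = a6 + w0 ∧
    combo a0 a1 a2 a3 a4 a5 a6 a7 w0 w1 w2 w3 (q 1 (xa 1)) = a7 ∧
    combo a0 a1 a2 a3 a4 a5 a6 a7 w0 w1 w2 w3 (q 1 (xa 2)) = a6 ∧
    combo a0 a1 a2 a3 a4 a5 a6 a7 w0 w1 w2 w3 (q 1 (xa 3)) = a7 + w1 + w2 := by
  refine ⟨?_, ?_, ?_, ?_, ?_, ?_, ?_, ?_, ?_, ?_, ?_, ?_, ?_, ?_, ?_, ?_⟩ <;>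
  · simp (config := { decide := true }) only [combo, wt, ↓reduceIte]
    ring

/-- **THE LATTICE THEOREM.**  An integer exponent vector on the sixteen labels is Pohlmann–Hodge for every `g ∈ G` iff it is an
integral combination of the eight conjugate pairs and the four atom monomials (rank `12 = 8 + 4`; with `combo_eq_zero` the twelve
form a `ℤ`-basis of the Hodge lattice).  Exact oracle `scratch/gen_octic2.py` (unimodular `12 × 12` minor, integral inverse = the
witnesses below). [cite: Pohlmann1968, Thm 1] -/
theorem isHodgeVec_iff (m : Pt → ℤ) :
    (∀ g : QuaternionGroup 2, hodgeForm g m = 0) ↔ ∃ a0 a1 a2 a3 a4 a5 a6 a7 w0 w1 w2 w3 : ℤ, ∀ x, m x = combo a0 a1 a2 a3 a4 a5 a6 a7 w0 w1 w2 w3 x := by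
  constructor
  · intro h
    rw [forall_g] at h
    simp only [hodgeForm_expand] at h
    obtain ⟨h0, h1, h2, h3, h4, h5, h6, h7⟩ := h
    refine ⟨m (q 0 (a 2)) + m (q 0 (xa 1)) - m (q 0 (xa 3)) + m (q 1 (a 1)) - m (q 1 (a 3)) + m (q 1 (xa 1)) - m (q 1 (xa 3)),
      m (q 0 (a 3)) + m (q 0 (xa 1)) - m (q 0 (xa 3)) + m (q 1 (xa 0)) + m (q 1 (xa 1)) - m (q 1 (xa 2)) - m (q 1 (xa 3)),
      -m (q 0 (xa 1)) + m (q 0 (xa 2)) + m (q 0 (xa 3)) - m (q 1 (a 1)) + m (q 1 (a 3)) - m (q 1 (xa 0)) + m (q 1 (xa 2)),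
      m (q 0 (xa 3)) - m (q 1 (a 1)) + m (q 1 (a 3)),
      -m (q 0 (xa 1)) + m (q 0 (xa 3)) - m (q 1 (a 1)) + m (q 1 (a 2)) + m (q 1 (a 3)),
      m (q 1 (a 3)),
      m (q 1 (xa 2)),
      m (q 1 (xa 1)),
      m (q 1 (xa 0)) - m (q 1 (xa 2)),
      m (q 0 (xa 1)) - m (q 0 (xa 3)) + m (q 1 (a 1)) - m (q 1 (a 3)),
      -m (q 0 (xa 1)) + m (q 0 (xa 3)) - m (q 1 (a 1)) + m (q 1 (a 3)) - m (q 1 (xa 1)) + m (q 1 (xa 3)),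
      m (q 1 (a 1)) - m (q 1 (a 3)) - m (q 1 (xa 0)) + m (q 1 (xa 2)), ?_⟩
    rw [forall_pt]
    simp only [combo_expand]
    refine ⟨?_, ?_, ?_, ?_, ?_, ?_, ?_, ?_, ?_, ?_, ?_, ?_, ?_, ?_, ?_, ?_⟩ <;> first | omega | trivial
  · rintro ⟨a0, a1, a2, a3, a4, a5, a6, a7, w0, w1, w2, w3, hm⟩
    rw [forall_pt] at hm
    simp only [combo_expand] at hm
    obtain ⟨p0, p1, p2, p3, p4, p5, p6, p7, p8, p9, p10, p11, p12, p13, p14, p15⟩ := hm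
    rw [forall_g]
    simp only [hodgeForm_expand]
    refine ⟨?_, ?_, ?_, ?_, ?_, ?_, ?_, ?_⟩ <;> omega

/-- The twelve generators are independent (so `isHodgeVec_iff` exhibits a `ℤ`-basis of the Hodge lattice). [folklore] -/
theorem combo_eq_zero (a0 a1 a2 a3 a4 a5 a6 a7 w0 w1 w2 w3 : ℤ) (h : ∀ x, combo a0 a1 a2 a3 a4 a5 a6 a7 w0 w1 w2 w3 x = 0) :
    a0 = 0 ∧ a1 = 0 ∧ a2 = 0 ∧ a3 = 0 ∧ a4 = 0 ∧ a5 = 0 ∧ a6 = 0 ∧ a7 = 0 ∧ w0 = 0 ∧ w1 = 0 ∧ w2 = 0 ∧ w3 = 0 := by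
  rw [forall_pt] at h
  simp only [combo_expand] at h
  omega

/-! ## The parity obstruction: at least 2 Galois orbits of atoms are needed -/

/-- The 2 parity functionals `λ_i(m) = Σ_{x ∈ T_i} m_x mod 2` (label sets `T_i`, unions of conjugate pairs). [folklore] -/
def paritySet : Fin 2 → Finset Pt := ![{q 0 (a 0), q 0 (a 2), q 0 (xa 0), q 0 (xa 2)}, {q 0 (a 0), q 0 (a 1), q 0 (a 2), q 0 (a 3)}]

/-- **Parity obstruction.**  (i) every `λ_i` vanishes on every conjugate pair; (ii) `λ_i` takes the same value on all `G`-translates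
of each orbit representative — with (i) and the lattice theorem this makes `λ_i` a `G`-INVARIANT functional `H → ℤ/2` on the Hodge
lattice, constant on every `G`-orbit and zero on the pairs; (iii) the values on the four basis atoms: the `2 × 4` matrix has rank `2` over
`𝔽₂` (unit columns at atoms `0, 3`).  Hence `(λ_i)_i : H → 𝔽₂^2` is onto, the image of `ℤ⟨pairs, k orbits⟩` has dimension `≤ k`, and NO
family of fewer than `2` Galois orbits of Hodge monomials generates the Hodge lattice together with the divisor classes: the
deficiency `2` of the lattice theorem is minimal (exact oracle `scratch/mu.py`: `2 = dim_{𝔽₂}` of the `G`-coinvariants of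
`(H/⟨pairs⟩) ⊗ 𝔽₂`). [folklore] -/
theorem parity_obstruction :
    (∀ i, ∀ x : Pt, (pairOf x ∩ paritySet i).card % 2 = 0) ∧
    (∀ i, ∀ j, ∀ g : QuaternionGroup 2, ((orbitRep j).image (act g) ∩ paritySet i).card % 2 = (orbitRep j ∩ paritySet i).card % 2) ∧
    ((atom 0 ∩ paritySet 0).card % 2 = 1 ∧ (atom 1 ∩ paritySet 0).card % 2 = 1 ∧ (atom 2 ∩ paritySet 0).card % 2 = 1 ∧ (atom 3 ∩ paritySet 0).card % 2 = 0 ∧ (atom 0 ∩ paritySet 1).card % 2 = 0 ∧ (atom 1 ∩ paritySet 1).card % 2 = 0 ∧ (atom 2 ∩ paritySet 1).card % 2 = 0 ∧ (atom 3 ∩ paritySet 1).card % 2 = 1) := by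
  refine ⟨by decide, by decide, by decide⟩

end Summit.HodgeConjecture.CorCM.Census.OcticQuaternionSpecies
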